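import Mathlib
import Literature.Computability.QuantumComplexity.SampleQueryAccess
import HarnessLib

/-!
# UniformSubsampleMoments — the plug-in moment estimator behind DEQ-A160 (pub-qadeq, unit deq-1)

HONEST FRAMING: instance-level adjudication of specific advantage claims; no claim about BQP vs BPP
or the summit.

Target adjudicated in `pub-qadeq-deq-1/DEQ-A160.md`: Yu, Rao, Wu, Liu, Liu, Wan, *Quantum-assisted anomaly
detection with multivariate Gaussian distribution*, arXiv:2505.02316v2 (2025).  The quantum algorithm outputs
additive-`ε` estimates of the column means `μ_j = (∑_i x_ij)/M` and covariances
`C_jk = (∑_i (x_ij − μ_j)(x_ik − μ_k))/(M−1)` of a classical data set `x ∈ (−1,1)^{M×D}` from ENTRY oracles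
(its eqs. (13)–(14)), and §5.2 of the paper argues that quantum-inspired (sample-and-query) dequantization does
not apply because only entry queries, operation (i), are assumed.

What is proved here (sorry-free, elementary):

* `cov_eq_plugin` — the plug-in identity `C_jk = (M/(M−1))·(S_jk − μ_j μ_k)` with `S_jk = (∑_i x_ij x_ik)/M`
  (the paper's eq. (3)), so estimating the first and second RAW moments suffices;
* `plugin_error_le` / `cov_plugin_error_le` — the error propagation used in Theorem A160-A and, on the quantum
  side, in the paper's "ε_C less than 3ε" (p. 10): if `|Ŝ − S| ≤ ε`, `|μ̂_a − μ_a| ≤ ε`, `|μ̂_b − μ_b| ≤ ε` and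
  `|μ̂_a| ≤ 1`, `|μ_b| ≤ 1`, then `|(Ŝ − μ̂_a μ̂_b) − (S − μ_a μ_b)| ≤ 3ε`, hence the covariance error is at most
  `(M/(M−1))·3ε`;
* `lengthSqDist_ones`, `tang_mean_ones`, `tang_secondMoment_ones_le` — Proposition A160-C in Lean: for the
  all-ones vector `e ∈ ℝ^M` the length-square distribution `𝒟_e` of the sample-and-query model IS the uniform
  distribution, and Tang's inner-product estimator `Z = y_i/e_i, i ∼ 𝒟_e` (tree:
  `Literature.Computability.QuantumComplexity.SampleQuery.sum_lengthSqDist_mul_div`, Tang STOC 2019 Prop. 4.2)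
  has mean `⟨e,y⟩/‖e‖² = (∑_i y_i)/M` = the column mean and second moment `≤ ‖y‖²/M ≤ 1` for `|y_i| ≤ 1`;
  i.e. "SQ(e) + Q(y)" — which the paper's operation (i) supplies — is exactly uniform row subsampling.

Not in this file (cell lead's splice note, 2026-08-21): the staged version carried a statement-level
`def UniformSubsampleSampleSize : Prop` (Theorem A160-A's sample size `N ≥ (2/ε²)·ln((D²+3D)/δ)`, Hoeffding
1963 + a union bound) that was proved nowhere; an unproved named `Prop` is a fact-def and is not filed
(D-0026) — the statement stays in DEQ-A160 §4 prose with its citation (Devroye–Györfi–Lugosi 1996 Thm 8.1)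
until it is proved from Mathlib's Hoeffding inequality.

No statement here is a cited Literature fact; nothing is imported by any other Summit file.
-/

noncomputable section

namespace Summit.QuantumAdvantage.Dequantization.UniformSubsampleMoments

open Finset
open Literature.Computability.QuantumComplexity.SampleQuery

/-! ### 1. Plug-in identity for the sample covariance (paper eq. (3)) -/

/-- `∑_i (a_i − ā)(b_i − b̄) = ∑_i a_i b_i − (∑ a)(∑ b)/M` for `ā = (∑ a)/M`, `b̄ = (∑ b)/M`, `M ≠ 0`. -/
theorem sum_centered_mul (M : ℕ) (hM : M ≠ 0) (a b : Fin M → ℝ) :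
    ∑ i, (a i - (∑ l, a l) / M) * (b i - (∑ l, b l) / M)
      = ∑ i, a i * b i - (∑ l, a l) * (∑ l, b l) / M := by
  have hMr : (M : ℝ) ≠ 0 := Nat.cast_ne_zero.mpr hM
  have h1 : ∀ i, (a i - (∑ l, a l) / M) * (b i - (∑ l, b l) / M)
      = a i * b i - ((∑ l, b l) / M) * a i - ((∑ l, a l) / M) * b i + ((∑ l, a l) / M) * ((∑ l, b l) / M) :=
    fun i => by ring
  simp_rw [h1, Finset.sum_add_distrib, Finset.sum_sub_distrib, ← Finset.mul_sum, Finset.sum_const,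
    Finset.card_univ, Fintype.card_fin, nsmul_eq_mul]
  field_simp
  ring

/-- The plug-in identity `C_jk = (M/(M−1))·(S_jk − μ_j μ_k)`:
`(∑_i (a_i − ā)(b_i − b̄))/(M−1) = (M/(M−1))·((∑ a_i b_i)/M − ā b̄)` for `M ≥ 2`. -/
theorem cov_eq_plugin (M : ℕ) (hM : 2 ≤ M) (a b : Fin M → ℝ) :
    (∑ i, (a i - (∑ l, a l) / M) * (b i - (∑ l, b l) / M)) / ((M : ℝ) - 1)
      = ((M : ℝ) / ((M : ℝ) - 1)) * ((∑ i, a i * b i) / M - ((∑ l, a l) / M) * ((∑ l, b l) / M)) := by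
  have hM0 : M ≠ 0 := by omega
  have hMr : (M : ℝ) ≠ 0 := Nat.cast_ne_zero.mpr hM0
  have hM1 : (M : ℝ) - 1 ≠ 0 := by
    have : (2 : ℝ) ≤ (M : ℝ) := by exact_mod_cast hM
    linarith
  rw [sum_centered_mul M hM0]
  field_simp
  try ring

/-! ### 2. Error propagation (Theorem A160-A; the paper's "ε_C less than 3ε") -/

/-- If `|Ŝ − S| ≤ ε`, `|μ̂a − μa| ≤ ε`, `|μ̂b − μb| ≤ ε`, `|μ̂a| ≤ 1`, `|μb| ≤ 1` then
`|(Ŝ − μ̂a μ̂b) − (S − μa μb)| ≤ 3ε`. -/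
theorem plugin_error_le {S S' μa μa' μb μb' ε : ℝ}
    (hS : |S' - S| ≤ ε) (ha : |μa' - μa| ≤ ε) (hb : |μb' - μb| ≤ ε)
    (ha1 : |μa'| ≤ 1) (hb1 : |μb| ≤ 1) :
    |(S' - μa' * μb') - (S - μa * μb)| ≤ 3 * ε := by
  have key : (S' - μa' * μb') - (S - μa * μb) = (S' - S) - μa' * (μb' - μb) - μb * (μa' - μa) := by ring
  rw [key]
  have h2 : |μa' * (μb' - μb)| ≤ ε := by
    rw [abs_mul]
    calc |μa'| * |μb' - μb| ≤ 1 * ε :=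
          mul_le_mul ha1 hb (abs_nonneg _) zero_le_one
      _ = ε := one_mul ε
  have h3 : |μb * (μa' - μa)| ≤ ε := by
    rw [abs_mul]
    calc |μb| * |μa' - μa| ≤ 1 * ε :=
          mul_le_mul hb1 ha (abs_nonneg _) zero_le_one
      _ = ε := one_mul ε
  calc |S' - S - μa' * (μb' - μb) - μb * (μa' - μa)|
      ≤ |S' - S - μa' * (μb' - μb)| + |μb * (μa' - μa)| := abs_sub _ _
    _ ≤ (|S' - S| + |μa' * (μb' - μb)|) + |μb * (μa' - μa)| := by
          gcongr; exact abs_sub _ _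
    _ ≤ (ε + ε) + ε := by gcongr
    _ = 3 * ε := by ring

/-- Covariance version with the Bessel factor: the plug-in estimate
`Ĉ = (M/(M−1))(Ŝ − μ̂a μ̂b)` is within `(M/(M−1))·3ε` of `C = (M/(M−1))(S − μa μb)`. -/
theorem cov_plugin_error_le {M : ℝ} (hM : 1 < M) {S S' μa μa' μb μb' ε : ℝ}
    (hS : |S' - S| ≤ ε) (ha : |μa' - μa| ≤ ε) (hb : |μb' - μb| ≤ ε)
    (ha1 : |μa'| ≤ 1) (hb1 : |μb| ≤ 1) :
    |M / (M - 1) * (S' - μa' * μb') - M / (M - 1) * (S - μa * μb)| ≤ M / (M - 1) * (3 * ε) := by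
  have hf : 0 ≤ M / (M - 1) := div_nonneg (by linarith) (by linarith)
  rw [← mul_sub, abs_mul, abs_of_nonneg hf]
  exact mul_le_mul_of_nonneg_left (plugin_error_le hS ha hb ha1 hb1) hf

/-! ### 3. Proposition A160-C: SQ access to the all-ones vector is uniform sampling, and Tang's
inner-product estimator with it is the subsample mean -/

section ones

variable {M : ℕ}

/-- the all-ones vector `e ∈ ℝ^M` -/
def ones (M : ℕ) : Fin M → ℝ := fun _ => 1

/-- Entries of the all-ones vector. -/
@[simp] theorem ones_apply (i : Fin M) : ones M i = 1 := rfl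

/-- `‖e‖² = M`. -/
theorem normSq_ones : normSq (ones M) = M := by
  simp [normSq, ones]

/-- `e ≠ 0` for `M ≥ 1`. -/
theorem ones_ne_zero (hM : M ≠ 0) : ones M ≠ 0 := by
  intro h
  have := congrFun h ⟨0, Nat.pos_of_ne_zero hM⟩
  simp [ones] at this

/-- `𝒟_e` is the uniform distribution: `𝒟_e(i) = e_i²/‖e‖² = 1/M`. -/
theorem lengthSqDist_ones (i : Fin M) : lengthSqDist (ones M) i = 1 / M := by
  simp [lengthSqDist, normSq_ones]

/-- Tang's estimator `Z = y_i / e_i`, `i ∼ 𝒟_e`, has mean `(∑_i y_i)/M` = the column mean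
(instance `x = e` of `SampleQuery.sum_lengthSqDist_mul_div`, Tang 2019 Prop. 4.2). -/
theorem tang_mean_ones (hM : M ≠ 0) (y : Fin M → ℝ) :
    ∑ i, lengthSqDist (ones M) i * (y i / ones M i) = (∑ i, y i) / M := by
  rw [sum_lengthSqDist_mul_div (ones_ne_zero hM) y, normSq_ones]
  simp [ones]

/-- … and second moment `E[Z²] ≤ ‖y‖²/‖e‖² = ‖y‖²/M` (Tang 2019 Prop. 4.2, second display). -/
theorem tang_secondMoment_ones_le (hM : M ≠ 0) (y : Fin M → ℝ) :
    ∑ i, lengthSqDist (ones M) i * (y i / ones M i) ^ 2 ≤ normSq y / M := by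
  have h := sum_lengthSqDist_mul_div_sq_le (ones_ne_zero hM) y
  rwa [normSq_ones] at h

/-- For entries bounded by one, `‖y‖²/M ≤ 1`: the single-sample second moment of the estimator is `≤ 1`
(so `O(log(1/δ)/ε²)` samples give additive error `ε = ε‖e‖‖y‖/M`, uniformly in `M`). -/
theorem normSq_div_le_one (hM : M ≠ 0) {y : Fin M → ℝ} (hy : ∀ i, |y i| ≤ 1) :
    normSq y / M ≤ 1 := by
  have hMr : (0 : ℝ) < M := by exact_mod_cast Nat.pos_of_ne_zero hM
  rw [div_le_one hMr, normSq]
  calc ∑ i, y i ^ 2 ≤ ∑ _i : Fin M, (1 : ℝ) := by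
        refine Finset.sum_le_sum fun i _ => ?_
        have h := hy i
        have : y i ^ 2 = |y i| ^ 2 := (sq_abs (y i)).symm
        rw [this]
        nlinarith [abs_nonneg (y i)]
    _ = M := by simp

/-- The same for the covariance summand `y_i = a_i b_i` (query access to `y_i` = two entry queries):
Tang's estimator with `SQ(e)` has mean `(∑_i a_i b_i)/M = S_ab`. -/
theorem tang_mean_ones_prod (hM : M ≠ 0) (a b : Fin M → ℝ) :
    ∑ i, lengthSqDist (ones M) i * ((a i * b i) / ones M i) = (∑ i, a i * b i) / M :=
  tang_mean_ones hM (fun i => a i * b i)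

end ones

end Summit.QuantumAdvantage.Dequantization.UniformSubsampleMoments

end
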